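import Summits.HodgeConjecture.HodgeConjecture.Theorems.MarkmanPartnerTransportIsometrySpannedThirdOfLefschetzStandard
import HarnessLib

/-!
# Route MarkmanPartnerTransport · the symmetric-form lemma of `…IsometrySpannedThirdScalarAllRanks` on the WEAK
# O'Grady clause `q^∨ = dualBBFClass 2 φ ∈ A²(X)` (task W-QX3 of the cell hodge-nonav, part 1 of 2)

`exists_algebraicClass_of_symmetricForm` (file `…ScalarAllRanks`) consumes the named fact
`OGrady2008_dualBBFClass_algebraic` only through its first clause `q^∨ ∈ A²(X)` (via
`OGrady2008_dualBBFClass_algebraic.exists_cup_cup_eq`; the integrality clause `(2/5)q^∨ ∈ H⁴(X;ℤ)` is never used),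
and that clause is a THEOREM of the tree granted `B(X)` and `b₃ = 0`
(`dualBBFClass_mem_algebraicClasses_of_lefschetzStandard`, file `…OfLefschetzStandard`). This file is the
append-only copy `exists_algebraicClass_of_symmetricForm_of_dualClass` with the hypothesis `hO` replaced by
`hqd : dualBBFClass 2 φ ∈ algebraicClasses X 2` (same proof, one `obtain` line changed; O'Grady's
`(q^∨ ∪ y) ∪ w = 25 q(y,w)·P` is the tree theorem `dualBBFClass_cup_cup`). Consumer: part 2,
`…IsometrySpannedThirdOfThreeFacts` (item #3 `IsometrySpannedThird`, stmt-HodgeConjecture-19651, BY NAME modulo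
three facts). Seat 20241-p1 g12; p1 g35 ruling 2026-08-28T06:05:10Z. No definition, no sorry; credits nothing.

References: K. O'Grady, *Mat. Contemp.* (2008) §3; S. Novario, Kyoto J. Math. 66 (2026) Props. 4.2–4.4;
C. Voisin, *Hodge Theory II* Prop. 9.20.
-/

noncomputable section

set_option linter.dupNamespace false

open Module CategoryTheory
open Literature.AlgebraicTopology.SingularHomology Literature.Geometry.Kaehler
open Literature.AlgebraicGeometry Literature.AlgebraicGeometry.Motives Literature.AlgebraicGeometry.HodgeTheory
open Literature.AlgebraicGeometry.Hyperkaehler Literature.AlgebraicGeometry.Surfaces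
open Summit.HodgeConjecture.HodgeConjecture.Theorems.NikulinTwinTransport
open Summit.HodgeConjecture.HodgeConjecture.Theorems.MarkmanPartnerTransport.BBFPositivity

namespace Summit.HodgeConjecture.HodgeConjecture.Theorems.MarkmanPartnerTransport.PartnerLattice

/-- `MarkedK3Sq[X, φ, P, z]`: VERBATIM the `let MarkedK3Sq := …` binder of the route declarations of
MarkmanPartnerTransport (clauses (m1)–(m6)). Local notation only. -/
local notation3 (prettyPrint := false) "MarkedK3Sq[" X ", " φ ", " P ", " z "]" =>
  (((IsIntegralClass P ∧ ∀ Q : complexBetti X (2 * 4), IsIntegralClass Q → ∃ n : ℤ, Q = n • P) ∧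
    (∀ c : complexBetti X 2, IsIntegralClass c ↔ ∃ v : K3HilbertIndex → ℤ, φ c = fun i => (v i : ℂ)) ∧
    (∀ a : complexBetti X 2, cupPowTwo a 4 = ((3 : ℂ) * (k3HilbertForm 2 (φ a) (φ a)) ^ 2) • P) ∧
    (IsOfHodgeType 4 X 2 2 0 (LinearEquiv.symm φ z) ∧
      ∀ τ : complexBetti X 2, IsOfHodgeType 4 X 2 2 0 τ → ∃ t : ℂ, τ = t • LinearEquiv.symm φ z) ∧
    (∀ c : complexBetti X 2, IsOfHodgeType 4 X 2 1 1 c ↔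
      (k3HilbertForm 2 (φ c) z = 0 ∧ k3HilbertForm 2 (φ c) (star z) = 0)) ∧
    (k3HilbertForm 2 z z = 0 ∧ 0 < (k3HilbertForm 2 (star z) z).re)))

/-- `Cup3[c, y, w] = (c ∪ y) ∪ w ∈ H⁸` for `c ∈ H⁴`, `y, w ∈ H²`. Local notation only. -/
local notation3 (prettyPrint := false) "Cup3[" c ", " y ", " w "]" =>
  cupProduct (rfl : 2 * 3 + 2 = 2 * 4) (cupProduct (rfl : 2 * 2 + 2 = 2 * 3) c y) w

variable {X : SchemeOver ℂ} {φ : complexBetti X 2 ≃ₗ[ℂ] (K3HilbertIndex → ℂ)} {P : complexBetti X (2 * 4)}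
  {z : K3HilbertIndex → ℂ}

/-! ### §1 The symmetric-form lemma on the weak clause `q^∨ ∈ A²(X)` -/

/-- **A symmetric bilinear form on `N¹(X)` plus a multiple of `q` is the cubic form of an ALGEBRAIC class —
on the weak clause `q^∨ ∈ A²(X)`** (copy of `exists_algebraicClass_of_symmetricForm` with `hO` replaced by
`hqd : dualBBFClass 2 φ ∈ algebraicClasses X 2`; O'Grady's `(q^∨ ∪ y) ∪ w = 25 q(y,w)·P` is the tree theorem
`dualBBFClass_cup_cup`). [cite: OGrady2008NumericalK3Square, §3]
[cite: Novario2026HodgeClassesHilbertSquares, Props. 4.2–4.4 (p. 4)] [cite: VoisinHodgeII2003, Prop. 9.20] -/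
theorem exists_algebraicClass_of_symmetricForm_of_dualClass
    (hcup : Voisin2003_cupProduct_algebraicClasses)
    (hX : IsSmoothProjective 4 X) (hM : MarkedK3Sq[X, φ, P, z])
    (hqd : dualBBFClass 2 φ ∈ algebraicClasses X 2) (a : ℂ) (β : complexBetti X 2 →ₗ[ℂ] complexBetti X 2 →ₗ[ℂ] ℂ) (hβsymm : ∀ y w, β y w = β w y)
    (r : complexBetti X 2 → complexBetti X 2) (hr : ∀ y, r y ∈ algebraicClasses X 1)
    (hqr : ∀ n ∈ algebraicClasses X 1, ∀ y : complexBetti X 2,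
      k3HilbertForm 2 (φ n) (φ (r y)) = k3HilbertForm 2 (φ n) (φ y)) :
    ∃ c' ∈ algebraicClasses X 2, ∀ y w : complexBetti X 2,
      Cup3[c', y, w] = (a * k3HilbertForm 2 (φ y) (φ w) + β (r y) (r w)) • P := by
  classical
  have hmk : IsMarkedK3Hilb 2 X φ P := isMarkedK3Hilb_of_marked hM
  haveI : FiniteDimensional ℂ (complexBetti X 2) := LinearEquiv.finiteDimensional φ.symm
  set N : Submodule ℂ (complexBetti X 2) := algebraicClasses X 1 with hNdef
  -- the restriction `qN` of `q` to `N` and a `q`-orthogonal basis `v` of `N`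
  set qN : LinearMap.BilinForm ℂ N := LinearMap.BilinForm.restrict
    ((Matrix.toBilin' (Matrix.map (k3HilbertGram 2) (Int.cast : ℤ → ℂ))).compl₁₂
      (φ : complexBetti X 2 →ₗ[ℂ] (K3HilbertIndex → ℂ)) (φ : complexBetti X 2 →ₗ[ℂ] (K3HilbertIndex → ℂ))) N
  have hqNapp : ∀ m n : N, qN m n = k3HilbertForm 2 (φ (m : complexBetti X 2)) (φ (n : complexBetti X 2)) :=
    fun m n => by rw [LinearMap.BilinForm.restrict_apply, LinearMap.domRestrict_apply,
      LinearMap.compl₁₂_apply, qC_apply]; rfl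
  have hqNsymm : LinearMap.IsSymm qN := ⟨fun m n => by
    show qN m n = qN n m
    rw [hqNapp, hqNapp, k3HilbertForm_comm]⟩
  haveI : Invertible (2 : ℂ) := invertibleOfNonzero two_ne_zero
  obtain ⟨v, hv⟩ := LinearMap.BilinForm.exists_orthogonal_basis (B := qN) hqNsymm
  have hvN : ∀ k, (v k : complexBetti X 2) ∈ algebraicClasses X 1 := fun k => (v k).2
  obtain ⟨cv, hcv⟩ : ∃ cv : Fin (Module.finrank ℂ N) → ℂ,
      ∀ k, cv k = k3HilbertForm 2 (φ (v k : complexBetti X 2)) (φ (v k : complexBetti X 2)) :=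
    ⟨fun k => k3HilbertForm 2 (φ (v k : complexBetti X 2)) (φ (v k : complexBetti X 2)), fun _ => rfl⟩
  have hvorth : ∀ k l, k ≠ l →
      k3HilbertForm 2 (φ (v k : complexBetti X 2)) (φ (v l : complexBetti X 2)) = 0 := by
    intro k l hkl
    have := hv hkl
    simp only [Function.onFun] at this
    rwa [hqNapp] at this
  have hcv0 : ∀ k, cv k ≠ 0 := by
    intro k h0
    rw [hcv] at h0
    have hℓ : qN (v k) = 0 := v.ext fun l => by
      rw [LinearMap.zero_apply, hqNapp]
      by_cases hkl : k = l
      · subst hkl; exact h0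
      · exact hvorth k l hkl
    have hperp : ∀ d ∈ algebraicClasses X 1, k3HilbertForm 2 (φ (v k : complexBetti X 2)) (φ d) = 0 := by
      intro d hd
      have := LinearMap.congr_fun hℓ ⟨d, hd⟩
      rwa [hqNapp, LinearMap.zero_apply] at this
    have h00 := k3HilbertForm_radical_algebraicClasses_one_eq_zero hX hM (hvN k) hperp
    exact v.ne_zero k (Subtype.ext h00)
  -- expansion of elements of `N` in the orthogonal basis: `n = Σ cₖ⁻¹ q(vₖ, n) vₖ`
  have hcoefN : ∀ (m : N) (k : Fin (Module.finrank ℂ N)),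
      v.repr m k * cv k = k3HilbertForm 2 (φ (v k : complexBetti X 2)) (φ (m : complexBetti X 2)) := by
    intro m k
    have h := congrArg (qN (v k)) (v.sum_repr m).symm
    rw [map_sum] at h
    simp only [map_smul, smul_eq_mul] at h
    rw [Finset.sum_eq_single k (fun l _ hlk => by rw [hv (Ne.symm hlk), mul_zero])
      (fun hk => absurd (Finset.mem_univ k) hk)] at h
    rw [hqNapp, hqNapp] at h
    rw [hcv, h, mul_comm]
  have hexp : ∀ m : N, (m : complexBetti X 2) = ∑ k, ((cv k)⁻¹ *
      k3HilbertForm 2 (φ (v k : complexBetti X 2)) (φ (m : complexBetti X 2))) • (v k : complexBetti X 2) := by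
    intro m
    have hrepr := congrArg (Subtype.val : N → complexBetti X 2) (v.sum_repr m).symm
    conv_lhs => rw [hrepr]
    rw [Submodule.coe_sum]
    refine Finset.sum_congr rfl fun k _ => ?_
    rw [Submodule.coe_smul, ← hcoefN m k, mul_comm (v.repr m k) (cv k), ← mul_assoc,
      inv_mul_cancel₀ (hcv0 k), one_mul]
  have hexp' : ∀ u : complexBetti X 2, u ∈ algebraicClasses X 1 → u = ∑ k, ((cv k)⁻¹ *
      k3HilbertForm 2 (φ (v k : complexBetti X 2)) (φ u)) • (v k : complexBetti X 2) :=
    fun u hu => hexp ⟨u, hu⟩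
  obtain ⟨s, hsdef⟩ : ∃ s : Fin (Module.finrank ℂ N) → Fin (Module.finrank ℂ N) → ℂ, ∀ k l,
      s k l = (cv k)⁻¹ * (cv l)⁻¹ * β (v k : complexBetti X 2) (v l : complexBetti X 2) :=
    ⟨fun k l => (cv k)⁻¹ * (cv l)⁻¹ * β (v k : complexBetti X 2) (v l : complexBetti X 2), fun _ _ => rfl⟩
  have hssymm : ∀ k l, s k l = s l k := fun k l => by rw [hsdef, hsdef, hβsymm]; ring
  -- `β(r y, r w) = Σ s_kl q(v_k, y) q(v_l, w)`
  have hβexp : ∀ y w, β (r y) (r w) =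
      ∑ k, ∑ l, s k l * k3HilbertForm 2 (φ (v k : complexBetti X 2)) (φ y) *
        k3HilbertForm 2 (φ (v l : complexBetti X 2)) (φ w) := by
    intro y w
    have hy := hexp' _ (hr y)
    have hw := hexp' _ (hr w)
    conv_lhs => rw [hy, hw]
    rw [LinearMap.map_sum₂]
    refine Finset.sum_congr rfl fun k _ => ?_
    rw [LinearMap.map_smul₂, map_sum, smul_eq_mul, Finset.mul_sum]
    refine Finset.sum_congr rfl fun l _ => ?_
    rw [map_smul, smul_eq_mul, hqr _ (hvN k), hqr _ (hvN l), hsdef]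
    ring
  obtain ⟨qd, hqdalg, hqd⟩ : ∃ qd ∈ algebraicClasses X 2, ∀ a b : complexBetti X 2,
      Cup3[qd, a, b] = ((25 : ℂ) * k3HilbertForm 2 (φ a) (φ b)) • P :=
    ⟨dualBBFClass 2 φ, hqd, dualBBFClass_cup_cup hmk⟩
  obtain ⟨t, htdef⟩ : ∃ t : ℂ, t = (a - ∑ k, ∑ l, s k l / 2 *
      k3HilbertForm 2 (φ (v k : complexBetti X 2)) (φ (v l : complexBetti X 2))) / 25 := ⟨_, rfl⟩
  obtain ⟨c', hc'def⟩ : ∃ c' : complexBetti X (2 * 2), c' = (∑ k, ∑ l, (s k l / 2) •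
      cupProduct (rfl : 2 + 2 = 2 * 2) (v k : complexBetti X 2) (v l : complexBetti X 2)) + t • qd :=
    ⟨_, rfl⟩
  have hc'alg : c' ∈ algebraicClasses X 2 := by
    rw [hc'def]
    refine Submodule.add_mem _ (Submodule.sum_mem _ fun k _ => Submodule.sum_mem _ fun l _ =>
      Submodule.smul_mem _ _ ?_) (Submodule.smul_mem _ _ hqdalg)
    exact hcup hX (a := 1) (b := 1) (hvN k) (hvN l)
  refine ⟨c', hc'alg, fun y w => ?_⟩
  have hL1 : ∀ A B : complexBetti X (2 * 2), Cup3[A + B, y, w] = Cup3[A, y, w] + Cup3[B, y, w] := by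
    intro A B; simp only [map_add, LinearMap.add_apply]
  have hL2 : ∀ (u : ℂ) (A : complexBetti X (2 * 2)), Cup3[u • A, y, w] = u • Cup3[A, y, w] := by
    intro u A; simp only [map_smul, LinearMap.smul_apply]
  have hL3 : ∀ A : Fin (Module.finrank ℂ N) → complexBetti X (2 * 2),
      Cup3[∑ k, A k, y, w] = ∑ k, Cup3[A k, y, w] := by
    intro A; simp only [map_sum, LinearMap.sum_apply]
  have hvv : ∀ k l,
      Cup3[cupProduct (rfl : 2 + 2 = 2 * 2) (v k : complexBetti X 2) (v l : complexBetti X 2), y, w] =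
        (k3HilbertForm 2 (φ (v k : complexBetti X 2)) (φ (v l : complexBetti X 2)) *
              k3HilbertForm 2 (φ y) (φ w) +
            k3HilbertForm 2 (φ (v k : complexBetti X 2)) (φ y) *
              k3HilbertForm 2 (φ (v l : complexBetti X 2)) (φ w) +
          k3HilbertForm 2 (φ (v k : complexBetti X 2)) (φ w) *
            k3HilbertForm 2 (φ (v l : complexBetti X 2)) (φ y)) • P :=
    fun k l => (cupFour_def _ _ _ _).symm.trans (cupFour_eq_of_isMarkedK3Hilb hmk _ _ _ _)
  have hrhs : Cup3[c', y, w] = ((∑ k, ∑ l, (s k l / 2) *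
      (k3HilbertForm 2 (φ (v k : complexBetti X 2)) (φ (v l : complexBetti X 2)) *
            k3HilbertForm 2 (φ y) (φ w) +
          k3HilbertForm 2 (φ (v k : complexBetti X 2)) (φ y) *
            k3HilbertForm 2 (φ (v l : complexBetti X 2)) (φ w) +
        k3HilbertForm 2 (φ (v k : complexBetti X 2)) (φ w) *
          k3HilbertForm 2 (φ (v l : complexBetti X 2)) (φ y))) +
      t * ((25 : ℂ) * k3HilbertForm 2 (φ y) (φ w))) • P := by
    rw [hc'def, hL1, hL3, hL2, hqd, smul_smul, add_smul, Finset.sum_smul]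
    congr 1
    refine Finset.sum_congr rfl fun k _ => ?_
    rw [hL3, Finset.sum_smul]
    refine Finset.sum_congr rfl fun l _ => ?_
    rw [hL2, hvv, smul_smul]
  -- the scalar identity
  have hsum2 : ∑ k, ∑ l, (s k l / 2) *
      (k3HilbertForm 2 (φ (v k : complexBetti X 2)) (φ y) * k3HilbertForm 2 (φ (v l : complexBetti X 2)) (φ w) +
        k3HilbertForm 2 (φ (v k : complexBetti X 2)) (φ w) * k3HilbertForm 2 (φ (v l : complexBetti X 2)) (φ y)) =
      ∑ k, ∑ l, s k l * k3HilbertForm 2 (φ (v k : complexBetti X 2)) (φ y) *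
        k3HilbertForm 2 (φ (v l : complexBetti X 2)) (φ w) := by
    have hswap : ∑ k, ∑ l, (s k l / 2) * (k3HilbertForm 2 (φ (v k : complexBetti X 2)) (φ w) *
        k3HilbertForm 2 (φ (v l : complexBetti X 2)) (φ y)) =
        ∑ k, ∑ l, (s k l / 2) * (k3HilbertForm 2 (φ (v k : complexBetti X 2)) (φ y) *
        k3HilbertForm 2 (φ (v l : complexBetti X 2)) (φ w)) := by
      rw [Finset.sum_comm]
      exact Finset.sum_congr rfl fun k _ => Finset.sum_congr rfl fun l _ => by rw [hssymm l k]; ring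
    simp only [mul_add, Finset.sum_add_distrib]
    rw [hswap, ← Finset.sum_add_distrib]
    refine Finset.sum_congr rfl fun k _ => ?_
    rw [← Finset.sum_add_distrib]
    exact Finset.sum_congr rfl fun l _ => by ring
  have hsplit : ∑ k, ∑ l, (s k l / 2) *
      (k3HilbertForm 2 (φ (v k : complexBetti X 2)) (φ (v l : complexBetti X 2)) * k3HilbertForm 2 (φ y) (φ w) +
          k3HilbertForm 2 (φ (v k : complexBetti X 2)) (φ y) * k3HilbertForm 2 (φ (v l : complexBetti X 2)) (φ w) +
        k3HilbertForm 2 (φ (v k : complexBetti X 2)) (φ w) * k3HilbertForm 2 (φ (v l : complexBetti X 2)) (φ y)) =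
      (∑ k, ∑ l, s k l / 2 * k3HilbertForm 2 (φ (v k : complexBetti X 2)) (φ (v l : complexBetti X 2))) *
          k3HilbertForm 2 (φ y) (φ w) +
        ∑ k, ∑ l, (s k l / 2) *
          (k3HilbertForm 2 (φ (v k : complexBetti X 2)) (φ y) * k3HilbertForm 2 (φ (v l : complexBetti X 2)) (φ w) +
            k3HilbertForm 2 (φ (v k : complexBetti X 2)) (φ w) *
              k3HilbertForm 2 (φ (v l : complexBetti X 2)) (φ y)) := by
    rw [Finset.sum_mul, ← Finset.sum_add_distrib]
    refine Finset.sum_congr rfl fun k _ => ?_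
    rw [Finset.sum_mul, ← Finset.sum_add_distrib]
    exact Finset.sum_congr rfl fun l _ => by ring
  rw [hrhs, hβexp, hsplit, hsum2, htdef]
  congr 1
  ring

end Summit.HodgeConjecture.HodgeConjecture.Theorems.MarkmanPartnerTransport.PartnerLattice

end
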